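import Summits.Ventures.CertifiedQuantumChemistry.Rows.HubbardRingTVEnergyFormula
import Summits.Ventures.CertifiedQuantumChemistry.Rows.HubbardRingTVWeakCoupling
import Summits.Ventures.CertifiedQuantumChemistry.Rows.HubbardHalfFilledStrongCoupling
import HarnessLib

/-!
# Ventures/CertifiedQuantumChemistry — Rows/HubbardRingTVAtomicLimit.lean: the ATOMIC LIMIT `t = 0` of
# the TV-H ring is solved EXACTLY by the level-DQG programme in EVERY sector and for BOTH signs of `U`:
# `OPT_DQG(L; 0, U; a, b) = E₀(L; 0, U; a, b) = U·(a + b − L)₊` (`U ≥ 0`), `= U·min(a, b)` (`U ≤ 0`)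

HONEST FRAMING (verbatim): certified bounds for a stated model Hamiltonian in a stated basis; not a
claim about the real molecule beyond that model.

Seat rdm-B, ROWS courtesy file (theorems only; no `def`, no notation, no instance; zero compute). Gen 37's
`Rows/HubbardRingTVZeroHopping.lean` settled the zero-hopping endpoint AT HALF FILLING (`a + b = L`, where
`OPT_DQG = E₀ = 0`); this file settles it in EVERY sector `a, b ≤ L` and for attractive `U` as well.
At `t = 0` the functional on any pair is `U` times the total doublon weight
`s(Γ) = Σ_p Γ_{(p↑,p↓),(p↑,p↓)}` (§2), so the programme's value is `U` times an END of the DOUBLON WINDOW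
of the feasible set; that window is the `N`-representable one (§1): the `Q`-condition's same-site pair
diagonal `e_p = 1 − γ_{p↑} − γ_{p↓} + d_p ≥ 0` summed over sites is the PIGEONHOLE `s ≥ N − L`
(Tr γ_αα = a, Tr γ_ββ = b), the `D`-diagonal is `s ≥ 0`, and gen 38's `G`-diagonal bound is the PAULI
ceiling `s ≤ min(a, b)`; both ends are attained by occupation-basis determinants `|α↑ ∪ β↓⟩`
(`s = |α ∩ β|`, §3), whose energy at `t = 0` is `U·|α ∩ β|`. Hence (§4) for `U ≥ 0` both `OPT_DQG` and
`E₀` equal `U·(a + b − L)₊`, for `U ≤ 0` both equal `U·min(a, b)`, and the certified gap VANISHES at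
`t = 0` in every sector — the `x = 0` endpoint of every sector's value function, not only S-U's.

* §1 `AtomicLimit.sum_doublon_re_ge_sub` (`(a + b) − |Λ| ≤ Σ_p Re d_p` on every `(a, b)`-sector-feasible
  pair of ANY orbital set `Λ`), `AtomicLimit.sum_doublon_re_mem_Icc` (the window
  `[(a + b − |Λ|)₊, min(a, b)]`, with gen 38's ceiling).
* §2 `hubbardRingTV_rdmEnergy_atomic` (`E(γ, Γ) = U·s(Γ)` at `t = 0`, every `L`, any `γ`, antisymmetric
  `Γ`), `hubbardRingTV_atomic_pqgSectorEnergy_ge_sub` (`U ≥ 0`: `OPT_DQG ≥ U·(a + b − L)₊`),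
  `hubbardRingTV_atomic_pqgSectorEnergy_ge_min` (`U ≤ 0`: `OPT_DQG ≥ U·min(a, b)`).
* §3 `hamiltonian_atomic_eq_smul_diagonal` (`H_G(0, U) = U·diag(#doubly occupied)` on any graph),
  `AtomicLimit.exists_card_inter_eq_sub` / `exists_card_inter_eq_min` (subsets of prescribed sizes with
  `|α ∩ β| = (a + b − L)₊` resp. `= min(a, b)`), `hubbardRingTV_atomic_energy_le_card_inter`
  (`E₀(L; 0, U; |α|, |β|) ≤ U·|α ∩ β|`), `hubbardRingTV_atomic_energy_le_sub`, `…_le_min` (every `U`).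
* §4 **`hubbardRingTV_atomic_values_of_nonneg`** (`U ≥ 0`: `OPT_DQG = U·(a + b − L)₊ ∧ E₀ = U·(a + b − L)₊`),
  **`hubbardRingTV_atomic_values_of_nonpos`** (`U ≤ 0`: both `= U·min(a, b)`),
  **`hubbardRingTV_atomic_exact`** (`OPT_DQG(L; 0, U; a, b) = E₀(L; 0, U; a, b)`, EVERY `U`, every
  `a, b ≤ L`), `hubbardRingTV_atomic_gap_eq_zero`, `hubbardRingTV_atomic_pqgT1T2p_exact` (the `T`-rung, by
  squeeze).

READING: statements about VALUES of the abstract programme and the exact sector energies of the cell's own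
model object at the single hopping value `t = 0`; nothing about `t ≠ 0`, no limit, no certificate, row or
value of record; S-U UNTOUCHED. All PROVED (0 sorry, standard axioms); no defs, no named facts.
References (docstring-only): D. A. Mazziotti, Adv. Chem. Phys. 134 (2007) ch. 3 §II.B eqs. (12), (14), §II.F;
E. H. Lieb, PRL 62 (1989) 1201 (sectors); H. Tasaki, *Physics and Mathematics of Quantum Many-Body
Systems* (2020) §9.3. Tree (REUSED): `sum_holon_sub_sum_doublon`, `qMap_apply_sameSite`
(`Rows/StrongCouplingBookkeeping`), `WeakCoupling.sum_doublon_re_nonneg` / `…_le_min` (gen 38),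
`StrongCouplingDoublon.interaction_eq`, `RingEnergy.hubbardRingTV_h_cast` / `…_eri_cast` (gen 39),
`hamiltonian_eq_add_smul_diagonal` (typer), `hubbardRingTV_hamiltonian_eq` (T-06 bridge),
`isInSector_single_pairSet`, `sectorGroundEnergy_le_of_rayleigh`, `le_pqgSectorEnergy_iff`,
`pqgSectorEnergy_le_sectorGroundEnergy`, `pqgSectorEnergy_le_pqgT1T2pSectorEnergy`,
`pqgT1T2pSectorEnergy_le_sectorGroundEnergy` (Literature), `doublyOccupied`, `upPart_pairSet`,
`downPart_pairSet` (Literature, Hubbard files). Mathlib: `Finset.exists_subset_card_eq`,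
`Finset.card_union_of_disjoint`, `Finset.card_compl`.
-/

noncomputable section

namespace Summit.Ventures.CertifiedQuantumChemistry

open Matrix Finset Literature.MathematicalPhysics.QuantumLattice Literature.MathematicalPhysics.QuantumChemistry
open Summit.Ventures.CertifiedQuantumChemistry.Hamiltonians
open scoped ComplexOrder

/-! ## §1 The doublon window of the sector-feasible set is the `N`-representable one -/

namespace AtomicLimit

section Abstract

variable {Λ : Type*} [LinearOrder Λ] [Fintype Λ]
variable {γ : Matrix (Orb Λ) (Orb Λ) ℂ} {Γ : Matrix (Orb Λ × Orb Λ) (Orb Λ × Orb Λ) ℂ}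

/-- **PIGEONHOLE ON THE FEASIBLE SET: `Σ_p Re d_p ≥ (a + b) − |Λ|`** on every `(a, b)`-sector-feasible
pair of the `D, Q, G` programme: the same-site pair diagonal of the `Q`-matrix,
`e_p = 1 − γ_{p↑,p↑} − γ_{p↓,p↓} + d_p` (Mazziotti eq. (14)), is non-negative (`Q ⪰ 0`) and sums to
`|Λ| − (a + b) + Σ_p d_p` (the sector rows). [folklore] -/
theorem sum_doublon_re_ge_sub {a b : ℕ} (hf : IsDQGFeasibleSector a b γ Γ) :
    ((a : ℝ) + b) - Fintype.card Λ ≤ ∑ p : Λ, (Γ (orb p 0, orb p 1) (orb p 0, orb p 1)).re := by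
  have h := congrArg Complex.re (sum_holon_sub_sum_doublon γ Γ hf)
  have he : 0 ≤ ∑ i : Λ, (qMap γ Γ (orb i 0, orb i 1) (orb i 0, orb i 1)).re :=
    Finset.sum_nonneg fun i _ => (Complex.nonneg_iff.1 (hf.dqg.q_psd.diag_nonneg (i := (orb i 0, orb i 1)))).1
  rw [Complex.sub_re, Complex.re_sum, Complex.re_sum] at h
  simp only [Complex.sub_re, Complex.add_re, Complex.natCast_re] at h
  linarith

/-- **THE DOUBLON WINDOW**: on every `(a, b)`-sector-feasible pair the total doublon weight lies in
`[(a + b − |Λ|)₊, min(a, b)]` (pigeonhole from `Q ⪰ 0`, `≥ 0` from `D ⪰ 0`, Pauli ceiling from `G ⪰ 0` —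
gen 38's `WeakCoupling.sum_doublon_re_le_min`): exactly the range of `#(doubly occupied sites)` over
`N`-electron occupation-basis states of the sector. [folklore] -/
theorem sum_doublon_re_mem_Icc {a b : ℕ} (hf : IsDQGFeasibleSector a b γ Γ) :
    ∑ p : Λ, (Γ (orb p 0, orb p 1) (orb p 0, orb p 1)).re ∈
      Set.Icc (((a + b - Fintype.card Λ : ℕ) : ℝ)) ((min a b : ℕ) : ℝ) := by
  refine ⟨?_, ?_⟩
  · rcases le_total (a + b) (Fintype.card Λ) with h | h
    · rw [Nat.sub_eq_zero_of_le h, Nat.cast_zero]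
      exact WeakCoupling.sum_doublon_re_nonneg hf
    · rw [Nat.cast_sub h, Nat.cast_add]
      exact sum_doublon_re_ge_sub hf
  · rw [Nat.cast_min]
    exact WeakCoupling.sum_doublon_re_le_min hf

end Abstract

/-! ### Subsets of `Fin L` with prescribed sizes and intersection -/

/-- Subsets `α, β ⊆ Fin L` with `|α| = a`, `|β| = b` and the MINIMAL overlap `|α ∩ β| = (a + b − L)₊`
(`a, b ≤ L`; `β` inside `αᶜ` if it fits, else `αᶜ` plus `a + b − L` elements of `α`). [folklore] -/
theorem exists_card_inter_eq_sub {L a b : ℕ} (ha : a ≤ L) (hb : b ≤ L) :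
    ∃ α β : Finset (Fin L), α.card = a ∧ β.card = b ∧ (α ∩ β).card = a + b - L := by
  classical
  obtain ⟨α, -, hα⟩ : ∃ α : Finset (Fin L), α ⊆ Finset.univ ∧ α.card = a :=
    Finset.exists_subset_card_eq (by rw [Finset.card_univ, Fintype.card_fin]; exact ha)
  have hαc : (αᶜ).card = L - a := by rw [Finset.card_compl, hα, Fintype.card_fin]
  rcases le_total (a + b) L with h | h
  · obtain ⟨β, hβ, hβc⟩ : ∃ β : Finset (Fin L), β ⊆ αᶜ ∧ β.card = b :=
      Finset.exists_subset_card_eq (by rw [hαc]; omega)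
    refine ⟨α, β, hα, hβc, ?_⟩
    rw [Nat.sub_eq_zero_of_le h, Finset.card_eq_zero, ← Finset.disjoint_iff_inter_eq_empty]
    exact Finset.disjoint_of_subset_right hβ disjoint_compl_right
  · obtain ⟨δ, hδ, hδc⟩ : ∃ δ : Finset (Fin L), δ ⊆ α ∧ δ.card = a + b - L :=
      Finset.exists_subset_card_eq (by rw [hα]; omega)
    have hdisj : Disjoint αᶜ δ := Finset.disjoint_of_subset_right hδ disjoint_compl_left
    refine ⟨α, αᶜ ∪ δ, hα, ?_, ?_⟩
    · rw [Finset.card_union_of_disjoint hdisj, hαc, hδc]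
      omega
    · rw [Finset.inter_union_distrib_left, Finset.inter_compl, Finset.empty_union,
        Finset.inter_eq_right.2 hδ, hδc]

/-- Subsets `α, β ⊆ Fin L` with `|α| = a`, `|β| = b` and the MAXIMAL overlap `|α ∩ β| = min(a, b)` (one
inside the other). [folklore] -/
theorem exists_card_inter_eq_min {L a b : ℕ} (ha : a ≤ L) (hb : b ≤ L) :
    ∃ α β : Finset (Fin L), α.card = a ∧ β.card = b ∧ (α ∩ β).card = min a b := by
  classical
  rcases le_total a b with h | h
  · obtain ⟨β, -, hβ⟩ : ∃ β : Finset (Fin L), β ⊆ Finset.univ ∧ β.card = b :=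
      Finset.exists_subset_card_eq (by rw [Finset.card_univ, Fintype.card_fin]; exact hb)
    obtain ⟨α, hαβ, hα⟩ : ∃ α : Finset (Fin L), α ⊆ β ∧ α.card = a :=
      Finset.exists_subset_card_eq (by rw [hβ]; exact h)
    refine ⟨α, β, hα, hβ, ?_⟩
    rw [Finset.inter_eq_left.2 hαβ, hα, Nat.min_eq_left h]
  · obtain ⟨α, -, hα⟩ : ∃ α : Finset (Fin L), α ⊆ Finset.univ ∧ α.card = a :=
      Finset.exists_subset_card_eq (by rw [Finset.card_univ, Fintype.card_fin]; exact ha)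
    obtain ⟨β, hβα, hβ⟩ : ∃ β : Finset (Fin L), β ⊆ α ∧ β.card = b :=
      Finset.exists_subset_card_eq (by rw [hα]; exact h)
    refine ⟨α, β, hα, hβ, ?_⟩
    rw [Finset.inter_eq_right.2 hβα, hβ, Nat.min_eq_right h]

end AtomicLimit

/-! ## §2 The functional at `t = 0` is `U` times the doublon weight; lower bounds on the feasible set -/

section Functional

variable (L : ℕ) (U : ℚ)

/-- **THE FUNCTIONAL AT ZERO HOPPING**: for every `L`, every `γ` and every `Γ` antisymmetric in each index
pair, `E(γ, Γ)[hubbardRingTV L 0 U] = U · Σ_p Γ_{(p↑,p↓),(p↑,p↓)}` (the one-body table vanishes, `E_core = 0`,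
and the on-site interaction term is the doublon weight, `StrongCouplingDoublon.interaction_eq`). [folklore] -/
theorem hubbardRingTV_rdmEnergy_atomic {γ : Matrix (Orb (Fin L)) (Orb (Fin L)) ℂ}
    {Γ : Matrix (Orb (Fin L) × Orb (Fin L)) (Orb (Fin L) × Orb (Fin L)) ℂ}
    (hfst : ∀ i j q, Γ (j, i) q = -Γ (i, j) q) (hsnd : ∀ p k l, Γ p (l, k) = -Γ p (k, l)) :
    rdmEnergy (fun p q => ((hubbardRingTV L 0 U).h p q : ℂ))
        (fun p q r s => ((hubbardRingTV L 0 U).eri p q r s : ℂ)) ((hubbardRingTV L 0 U).ecore : ℂ) γ Γ =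
      (U : ℂ) * ∑ p : Fin L, Γ (orb p 0, orb p 1) (orb p 0, orb p 1) := by
  have hcore : (((hubbardRingTV L 0 U).ecore : ℚ) : ℂ) = 0 := by simp [hubbardRingTV]
  have hh : ∀ p q : Fin L, (((hubbardRingTV L 0 U).h p q : ℚ) : ℂ) = 0 := by
    intro p q
    rw [RingEnergy.hubbardRingTV_h_cast]
    simp
  rw [rdmEnergy, StrongCouplingDoublon.interaction_eq hfst hsnd (U : ℂ) (RingEnergy.hubbardRingTV_eri_cast 0 U),
    hcore, add_zero]
  simp only [hh, zero_mul, Finset.sum_const_zero, zero_add]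

/-- On a sector-feasible pair at `t = 0`: `Re E(γ, Γ) = U · Σ_p Re d_p`. [folklore] -/
theorem hubbardRingTV_re_rdmEnergy_atomic {a b : ℕ} {γ : Matrix (Orb (Fin L)) (Orb (Fin L)) ℂ}
    {Γ : Matrix (Orb (Fin L) × Orb (Fin L)) (Orb (Fin L) × Orb (Fin L)) ℂ} (hf : IsDQGFeasibleSector a b γ Γ) :
    (rdmEnergy (fun p q => ((hubbardRingTV L 0 U).h p q : ℂ))
        (fun p q r s => ((hubbardRingTV L 0 U).eri p q r s : ℂ)) ((hubbardRingTV L 0 U).ecore : ℂ) γ Γ).re =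
      (U : ℝ) * ∑ p : Fin L, (Γ (orb p 0, orb p 1) (orb p 0, orb p 1)).re := by
  rw [hubbardRingTV_rdmEnergy_atomic L U hf.dqg.swap_fst hf.dqg.swap_snd, ← Complex.ofReal_ratCast,
    Complex.re_ofReal_mul, Complex.re_sum]

variable {L}

/-- **REPULSIVE LOWER BOUND: `OPT_DQG(L; 0, U; a, b) ≥ U·(a + b − L)₊`** for `U ≥ 0`, `a, b ≤ L` (the
pigeonhole end of the doublon window, §1). [folklore] -/
theorem hubbardRingTV_atomic_pqgSectorEnergy_ge_sub {U : ℚ} (hU : 0 ≤ U) {a b : ℕ} (ha : a ≤ L) (hb : b ≤ L) :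
    (U : ℝ) * ((a + b - L : ℕ) : ℝ) ≤ Model.pqgSectorEnergy (hubbardRingTV L 0 U) a b := by
  have ha' : a ≤ Fintype.card (Fin L) := by rw [Fintype.card_fin]; exact ha
  have hb' : b ≤ Fintype.card (Fin L) := by rw [Fintype.card_fin]; exact hb
  unfold Model.pqgSectorEnergy
  refine (le_pqgSectorEnergy_iff _ _ _ ha' hb').2 fun γ Γ hf => ?_
  rw [hubbardRingTV_re_rdmEnergy_atomic L U hf]
  refine mul_le_mul_of_nonneg_left ?_ (by exact_mod_cast hU)
  have h := (AtomicLimit.sum_doublon_re_mem_Icc hf).1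
  rwa [Fintype.card_fin] at h

/-- **ATTRACTIVE LOWER BOUND: `OPT_DQG(L; 0, U; a, b) ≥ U·min(a, b)`** for `U ≤ 0`, `a, b ≤ L` (the Pauli
end of the doublon window). [folklore] -/
theorem hubbardRingTV_atomic_pqgSectorEnergy_ge_min {U : ℚ} (hU : U ≤ 0) {a b : ℕ} (ha : a ≤ L) (hb : b ≤ L) :
    (U : ℝ) * ((min a b : ℕ) : ℝ) ≤ Model.pqgSectorEnergy (hubbardRingTV L 0 U) a b := by
  have ha' : a ≤ Fintype.card (Fin L) := by rw [Fintype.card_fin]; exact ha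
  have hb' : b ≤ Fintype.card (Fin L) := by rw [Fintype.card_fin]; exact hb
  unfold Model.pqgSectorEnergy
  refine (le_pqgSectorEnergy_iff _ _ _ ha' hb').2 fun γ Γ hf => ?_
  rw [hubbardRingTV_re_rdmEnergy_atomic L U hf]
  exact mul_le_mul_of_nonpos_left (AtomicLimit.sum_doublon_re_mem_Icc hf).2 (by exact_mod_cast hU)

end Functional

/-! ## §3 The exact side: determinants `|α↑ ∪ β↓⟩` have energy `U·|α ∩ β|` at `t = 0` -/

section Exact

/-- **The graph Hubbard Hamiltonian at zero hopping is diagonal in the occupation basis**: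
`H_G(0, U) = U · diag(#doubly occupied sites)` (any finite graph). [folklore] -/
theorem hamiltonian_atomic_eq_smul_diagonal {Λ : Type*} [LinearOrder Λ] [Fintype Λ] (G : SimpleGraph Λ)
    [DecidableRel G.Adj] (U : ℝ) :
    hamiltonian G 0 U = (U : ℂ) • diagonal (fun s => ((((doublyOccupied s).card : ℕ) : ℝ) : ℂ)) := by
  rw [hamiltonian_eq_add_smul_diagonal G 0 U]
  have h0 : hamiltonian G 0 0 = 0 := by
    simp [hamiltonian]
  rw [h0, zero_add]

variable {L : ℕ} (U : ℚ)

/-- **`E₀(L; 0, U; |α|, |β|) ≤ U·|α ∩ β|`** for all `α, β ⊆ Fin L` and every `U`: the Rayleigh quotient of the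
occupation-basis vector `|α↑ ∪ β↓⟩`, which lies in the sector `(|α|, |β|)` and is an eigenvector of the
diagonal `H(0, U)` with eigenvalue `U·#(doubly occupied sites) = U·|α ∩ β|`. [folklore] -/
theorem hubbardRingTV_atomic_energy_le_card_inter (α β : Finset (Fin L)) :
    Model.energy (hubbardRingTV L 0 U) α.card β.card ≤ (U : ℝ) * ((α ∩ β).card : ℝ) := by
  classical
  have hsec : IsInSector α.card β.card (Pi.single (pairSet α β) (1 : ℂ) : Fock (Orb (Fin L))) :=
    isInSector_single_pairSet α β
  have hne : (Pi.single (pairSet α β) (1 : ℂ) : Fock (Orb (Fin L))) ≠ 0 := by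
    intro h0
    have h1 := congrFun h0 (pairSet α β)
    simp at h1
  unfold Model.energy
  refine sectorGroundEnergy_le_of_rayleigh (hubbardRingTV_hamiltonian_isHermitian L 0 U) hsec hne ?_
  have hdiag : (hubbardRingTV L 0 U).hamiltonian (pairSet α β) (pairSet α β) =
      (((U : ℝ) : ℝ) : ℂ) * ((((α ∩ β).card : ℕ) : ℝ) : ℂ) := by
    rw [hubbardRingTV_hamiltonian_eq, Rat.cast_zero, hamiltonian_atomic_eq_smul_diagonal, Matrix.smul_apply,
      Matrix.diagonal_apply_eq, doublyOccupied, upPart_pairSet, downPart_pairSet, smul_eq_mul]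
  have hq : star (Pi.single (pairSet α β) (1 : ℂ) : Fock (Orb (Fin L))) ⬝ᵥ
      (hubbardRingTV L 0 U).hamiltonian *ᵥ Pi.single (pairSet α β) 1
      = (hubbardRingTV L 0 U).hamiltonian (pairSet α β) (pairSet α β) := by
    rw [← Pi.single_star, star_one, Matrix.mulVec_single_one, single_dotProduct, one_mul, Matrix.col_apply]
  have hn : star (Pi.single (pairSet α β) (1 : ℂ) : Fock (Orb (Fin L))) ⬝ᵥ Pi.single (pairSet α β) 1 = 1 := by
    rw [← Pi.single_star, star_one, single_dotProduct, one_mul, Pi.single_eq_same]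
  rw [hq, hdiag, hn, Complex.one_re, mul_one, ← Complex.ofReal_mul, Complex.ofReal_re]

/-- **`E₀(L; 0, U; a, b) ≤ U·(a + b − L)₊`** for every `U` and `a, b ≤ L` (a determinant with the fewest
doubly occupied sites). [folklore] -/
theorem hubbardRingTV_atomic_energy_le_sub {a b : ℕ} (ha : a ≤ L) (hb : b ≤ L) :
    Model.energy (hubbardRingTV L 0 U) a b ≤ (U : ℝ) * ((a + b - L : ℕ) : ℝ) := by
  obtain ⟨α, β, hα, hβ, hαβ⟩ := AtomicLimit.exists_card_inter_eq_sub ha hb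
  have h := hubbardRingTV_atomic_energy_le_card_inter U α β
  rwa [hα, hβ, hαβ] at h

/-- **`E₀(L; 0, U; a, b) ≤ U·min(a, b)`** for every `U` and `a, b ≤ L` (a determinant with the most doubly
occupied sites). [folklore] -/
theorem hubbardRingTV_atomic_energy_le_min {a b : ℕ} (ha : a ≤ L) (hb : b ≤ L) :
    Model.energy (hubbardRingTV L 0 U) a b ≤ (U : ℝ) * ((min a b : ℕ) : ℝ) := by
  obtain ⟨α, β, hα, hβ, hαβ⟩ := AtomicLimit.exists_card_inter_eq_min ha hb
  have h := hubbardRingTV_atomic_energy_le_card_inter U α β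
  rwa [hα, hβ, hαβ] at h

end Exact

/-! ## §4 The atomic limit is exact in every sector, for both signs of `U` -/

section Values

variable {L : ℕ}

/-- `OPT_DQG(L; 0, U; a, b) ≤ E₀(L; 0, U; a, b)` (the relaxation bound, every `U`, `a, b ≤ L`). [folklore] -/
theorem hubbardRingTV_atomic_pqgSectorEnergy_le_energy (U : ℚ) {a b : ℕ} (ha : a ≤ L) (hb : b ≤ L) :
    Model.pqgSectorEnergy (hubbardRingTV L 0 U) a b ≤ Model.energy (hubbardRingTV L 0 U) a b :=
  pqgSectorEnergy_le_sectorGroundEnergy (hubbardRingTV_hamiltonian_isHermitian L 0 U)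
    (by rw [Fintype.card_fin]; exact ha) (by rw [Fintype.card_fin]; exact hb)

/-- **THE REPULSIVE ATOMIC LIMIT, EVERY SECTOR**: for `U ≥ 0` and `a, b ≤ L`,
`OPT_DQG(L; 0, U; a, b) = U·(a + b − L)₊` AND `E₀(L; 0, U; a, b) = U·(a + b − L)₊` — `U` per electron
that cannot avoid an occupied site. [folklore] -/
theorem hubbardRingTV_atomic_values_of_nonneg {U : ℚ} (hU : 0 ≤ U) {a b : ℕ} (ha : a ≤ L) (hb : b ≤ L) :
    Model.pqgSectorEnergy (hubbardRingTV L 0 U) a b = (U : ℝ) * ((a + b - L : ℕ) : ℝ) ∧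
      Model.energy (hubbardRingTV L 0 U) a b = (U : ℝ) * ((a + b - L : ℕ) : ℝ) := by
  have h1 := hubbardRingTV_atomic_pqgSectorEnergy_ge_sub hU ha hb
  have h2 := hubbardRingTV_atomic_pqgSectorEnergy_le_energy U ha hb
  have h3 := hubbardRingTV_atomic_energy_le_sub U ha hb
  exact ⟨le_antisymm (h2.trans h3) h1, le_antisymm h3 (h1.trans h2)⟩

/-- **THE ATTRACTIVE ATOMIC LIMIT, EVERY SECTOR**: for `U ≤ 0` and `a, b ≤ L`,
`OPT_DQG(L; 0, U; a, b) = U·min(a, b)` AND `E₀(L; 0, U; a, b) = U·min(a, b)` — every minority electron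
paired. [folklore] -/
theorem hubbardRingTV_atomic_values_of_nonpos {U : ℚ} (hU : U ≤ 0) {a b : ℕ} (ha : a ≤ L) (hb : b ≤ L) :
    Model.pqgSectorEnergy (hubbardRingTV L 0 U) a b = (U : ℝ) * ((min a b : ℕ) : ℝ) ∧
      Model.energy (hubbardRingTV L 0 U) a b = (U : ℝ) * ((min a b : ℕ) : ℝ) := by
  have h1 := hubbardRingTV_atomic_pqgSectorEnergy_ge_min hU ha hb
  have h2 := hubbardRingTV_atomic_pqgSectorEnergy_le_energy U ha hb
  have h3 := hubbardRingTV_atomic_energy_le_min U ha hb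
  exact ⟨le_antisymm (h2.trans h3) h1, le_antisymm h3 (h1.trans h2)⟩

/-- **THE ATOMIC LIMIT IS SOLVED EXACTLY BY LEVEL DQG IN EVERY SECTOR, FOR EVERY `U`**:
`OPT_DQG(hubbardRingTV L 0 U; a, b) = E₀(hubbardRingTV L 0 U; a, b)` for all rational `U` and all
`a, b ≤ L`. [folklore] -/
theorem hubbardRingTV_atomic_exact (U : ℚ) {a b : ℕ} (ha : a ≤ L) (hb : b ≤ L) :
    Model.pqgSectorEnergy (hubbardRingTV L 0 U) a b = Model.energy (hubbardRingTV L 0 U) a b := by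
  rcases le_total 0 U with hU | hU
  · obtain ⟨h1, h2⟩ := hubbardRingTV_atomic_values_of_nonneg hU ha hb
    rw [h1, h2]
  · obtain ⟨h1, h2⟩ := hubbardRingTV_atomic_values_of_nonpos hU ha hb
    rw [h1, h2]

/-- … so the certified gap `E₀ − OPT_DQG` VANISHES at `t = 0` in every sector, for every `U`. [folklore] -/
theorem hubbardRingTV_atomic_gap_eq_zero (U : ℚ) {a b : ℕ} (ha : a ≤ L) (hb : b ≤ L) :
    Model.energy (hubbardRingTV L 0 U) a b - Model.pqgSectorEnergy (hubbardRingTV L 0 U) a b = 0 := by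
  rw [hubbardRingTV_atomic_exact U ha hb, sub_self]

/-- **… and the `T`-rung is exact at `t = 0` too** (squeezed between `OPT_DQG` and `E₀`):
`OPT_DQGT1T2′(hubbardRingTV L 0 U; a, b) = E₀(hubbardRingTV L 0 U; a, b)`, every `U`, `a, b ≤ L` (the
Literature value function on the ring's cast tables). [folklore] -/
theorem hubbardRingTV_atomic_pqgT1T2p_exact (U : ℚ) {a b : ℕ} (ha : a ≤ L) (hb : b ≤ L) :
    pqgT1T2pSectorEnergy (fun p q => (((hubbardRingTV L 0 U).h p q : ℚ) : ℂ))
        (fun p q r s => (((hubbardRingTV L 0 U).eri p q r s : ℚ) : ℂ))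
        (((hubbardRingTV L 0 U).ecore : ℚ) : ℂ) a b = Model.energy (hubbardRingTV L 0 U) a b := by
  have ha' : a ≤ Fintype.card (Fin L) := by rw [Fintype.card_fin]; exact ha
  have hb' : b ≤ Fintype.card (Fin L) := by rw [Fintype.card_fin]; exact hb
  have hH := hubbardRingTV_hamiltonian_isHermitian L 0 U
  have heq := hubbardRingTV_atomic_exact U ha hb
  unfold Model.pqgSectorEnergy at heq
  unfold Model.energy Model.hamiltonian at heq hH ⊢
  exact le_antisymm (pqgT1T2pSectorEnergy_le_sectorGroundEnergy hH ha' hb')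
    (heq.symm.le.trans (pqgSectorEnergy_le_pqgT1T2pSectorEnergy _ _ _ ha' hb'))

/-- The doublon window of §1 on the ring, read at an OPTIMAL pair: at `t = 0` the optimiser's doublon weight
is pinned to an END of the window — `Σ_p Re d_p = (a + b − L)₊` when `U > 0`, `= min(a, b)` when `U < 0`
(for any feasible pair whose energy equals the programme's value). [folklore] -/
theorem hubbardRingTV_atomic_optimal_doublon (U : ℚ) {a b : ℕ} (ha : a ≤ L) (hb : b ≤ L)
    {γ : Matrix (Orb (Fin L)) (Orb (Fin L)) ℂ} {Γ : Matrix (Orb (Fin L) × Orb (Fin L)) (Orb (Fin L) × Orb (Fin L)) ℂ}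
    (hf : IsDQGFeasibleSector a b γ Γ)
    (hopt : (rdmEnergy (fun p q => ((hubbardRingTV L 0 U).h p q : ℂ))
        (fun p q r s => ((hubbardRingTV L 0 U).eri p q r s : ℂ)) ((hubbardRingTV L 0 U).ecore : ℂ) γ Γ).re =
        Model.pqgSectorEnergy (hubbardRingTV L 0 U) a b) :
    (0 < U → ∑ p : Fin L, (Γ (orb p 0, orb p 1) (orb p 0, orb p 1)).re = ((a + b - L : ℕ) : ℝ)) ∧
      (U < 0 → ∑ p : Fin L, (Γ (orb p 0, orb p 1) (orb p 0, orb p 1)).re = ((min a b : ℕ) : ℝ)) := by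
  rw [hubbardRingTV_re_rdmEnergy_atomic L U hf] at hopt
  have hw := AtomicLimit.sum_doublon_re_mem_Icc hf
  rw [Fintype.card_fin] at hw
  refine ⟨fun hpos => ?_, fun hneg => ?_⟩
  · rw [(hubbardRingTV_atomic_values_of_nonneg hpos.le ha hb).1] at hopt
    have hU' : (0 : ℝ) < U := by exact_mod_cast hpos
    exact mul_left_cancel₀ hU'.ne' hopt
  · rw [(hubbardRingTV_atomic_values_of_nonpos hneg.le ha hb).1] at hopt
    have hU' : (U : ℝ) < 0 := by exact_mod_cast hneg
    exact mul_left_cancel₀ hU'.ne hopt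

end Values

end Summit.Ventures.CertifiedQuantumChemistry

end
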